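import Literature.AlgebraicGeometry.AbelianSchemes.AbelianSchemeHomDescentFlatSurjective
import Literature.AlgebraicGeometry.AbelianSchemes.AbelianSchemeOverRingAction
import HarnessLib

/-!
# Descent through a flat surjective homomorphism is EQUIVARIANT: intertwined endomorphisms, descended ring actions,
# and the `𝒪`-equivariance of the recognition isomorphism ([MumfordAV1970] §7 Thm. 4)

Topic `Literature/AlgebraicGeometry/AbelianSchemes`, namespace `Literature.AlgebraicGeometry.AbelianSchemes.AbelianSchemeOver` (two
constructions with bodies — the DESCENDED endomorphisms and ring action — + proved theorems; no named fact, no `sorry`, no `instance`, no notation; ANY base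
scheme `S`).  Cell `hodgecm-mathlib`, F0/P6 «MOD», organ **ST-2b (core)** of desk F0P6a-plan (g0) (ED3-CENSUS-P6a v1 §3∕§6, 2026-09-01T15:17:51Z:
«two isogenies out of `A′` with the same kernel differ by a unique isomorphism, compatibly with `ι`») = the any-base, `RingAction`-currency twin of
★ `Motives/AbelianVarietyIsogenyDescent` §4 (F0P6-p10, over a field), on top of ★ (o-c3k) `AbelianSchemeHomDescentFlatSurjective`;
`--supports stmt-HodgeConjecture-24832`, count-neutral.  HC_CM is proved only modulo the 2 remaining named inputs (hLiu418, h413) until rung 0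
closes; this file discharges none of them.

## Mathematics

Let `ψ : A → C` be a homomorphism of abelian `S`-schemes whose underlying map is flat, surjective and quasi-compact (e.g. an isogeny).  Then
`ψ.left` is an effective epimorphism of schemes (fpqc, [SGA1] VIII 5.2), so `ψ` is LEFT-CANCELLABLE in `Over S` (§1).  Consequently every
factorisation `ψ ≫ χ = φ` (★ (o-c3k): it exists uniquely as soon as `φ` kills `Ker ψ` on points) is FUNCTORIAL: morphisms `a, c, b`
intertwining two such triples intertwine the factors (`c ≫ χ′ = χ ≫ b`), endomorphisms `εA, εC, εB` with `εA ψ = ψ εC`, `εA φ = φ εB` give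
`εC χ = χ εB`, and the recognition isomorphism `e : C ≅ B` (★ `exists_iso_comp_eq_of_forall_comp_eq_one`) is equivariant (§2).  For a ring
action `ι : 𝒪 → End(A)` (★ `RingAction`) STABILISING `Ker ψ` on points (`t ψ = 1 ⇒ (t ι(a)) ψ = 1`; automatic when `Ker ψ = A[𝔭]` is cut
out by the action itself, §3) each `ι(a) ≫ ψ` descends uniquely through `ψ`, and the descents form a ring action `ι_C` on `C` — the UNIQUE one
making `ψ` equivariant (§3: `RingAction.descend`).  Finally (§4) two `𝒪`-equivariant finite flat homomorphisms `ψ : A → C` (surjective) and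
`φ : A → B` of the same constant degree with `φ` killing `Ker ψ` are isomorphic under `A` by a unique, `𝒪`-EQUIVARIANT isomorphism — the
shape in which GEN∕HEART identify «the quotient of `(A, ι)` by `A[𝔭]`» with «`(A ⊗_𝒪 𝔭⁻¹, ι)`» (★ `SerreTensorIdealTranslationKernel`) and
transport `ι` along `quot`∕`transl`.

## Contents

* §1 `cancel_left_of_flat_surjective` (`ψ ≫ x = ψ ≫ y → x = y` for `x y : C.X ⟶ D`, any `D : Over S`).
* §2 `comp_factor_eq_factor_comp`, `comp_factor_eq_factor_comp_of_endo`, `comp_iso_eq_iso_comp_of_endo`.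
* §3 `RingAction.stabilises_ker_of_comp_eq` (equivariant ⇒ stabilises), `RingAction.stabilises_ker_of_ker_eq_torsion` (`Ker ψ = A[𝔭]` ⇒ stabilises),
  `RingAction.exists_descend_i`, `RingAction.descendMap` (def; `isMonHom_descendMap`, `comp_descendMap`, `descendMap_unique`),
  **`RingAction.descend`** (def; `descend_i`), **`RingAction.i_comp_eq_comp_descend_i`** (`ι(a) ≫ ψ = ψ ≫ ι_C(a)`),
  **`RingAction.descend_i_unique`**, `RingAction.eq_descend_i_of_comp_eq`.
* §4 **`exists_iso_comp_eq_equivariant_of_forall_comp_eq_one`** (the `𝒪`-equivariant recognition, with uniqueness),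
  `comp_factor_equivariant` (the factor `χ` alone is equivariant).

## References
* [MumfordAV1970] D. Mumford, *Abelian Varieties* (1970), §7 Thm. 4 (p. 72) (isogenies ↔ finite subgroups; factorisation is unique).
* [SGA1] A. Grothendieck, *SGA 1*, Exp. VIII Thm. 5.2 (fpqc morphisms are effective epimorphisms).
* [Conrad2004GrossZagier] B. Conrad, *Gross–Zagier revisited*, MSRI Publ. 49 (2004), §7 (the `𝒪`-structure on Serre tensors ∕ quotients).
* Tree: ★ `AbelianSchemes/AbelianSchemeHomDescentFlatSurjective` (o-c3k), ★ `AbelianSchemes/AbelianSchemeOverRingAction`,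
  ★ `Motives/AbelianVarietyIsogenyDescent` §4 (field twin).
-/

noncomputable section

universe u

open CategoryTheory CategoryTheory.Limits AlgebraicGeometry MonoidalCategory CartesianMonoidalCategory
open scoped MonObj

namespace Literature.AlgebraicGeometry.AbelianSchemes

namespace AbelianSchemeOver

variable {S : Scheme.{u}} (A : AbelianSchemeOver S) {B C : AbelianSchemeOver S} (ψ : A.X ⟶ C.X)

/-! ## §1 A flat surjective quasi-compact homomorphism is left-cancellable in `Over S` -/

/-- **`ψ` is an epimorphism**: for `ψ.left` flat, surjective and quasi-compact (an fpqc cover, hence an effective epimorphism of schemes),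
`ψ ≫ x = ψ ≫ y → x = y` for all `x y : C ⟶ D` over `S`. [cite: SGA1, Exp. VIII Thm. 5.2] [cite: MumfordAV1970, §7 Thm. 4 (p. 72)] -/
theorem cancel_left_of_flat_surjective [Flat ψ.left] [Surjective ψ.left] [QuasiCompact ψ.left] {D : Over S} {x y : C.X ⟶ D}
    (h : ψ ≫ x = ψ ≫ y) : x = y := by
  apply Over.OverMorphism.ext
  rw [← cancel_epi ψ.left, ← Over.comp_left, h, Over.comp_left]

/-! ## §2 Factorisations through `ψ` are functorial ∕ equivariant -/

section Functorial

variable [Flat ψ.left] [Surjective ψ.left] [QuasiCompact ψ.left]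

/-- **FUNCTORIALITY OF DESCENT**: factorisations `ψ ≫ χ = φ` and `ψ′ ≫ χ′ = φ′` intertwined by `a : A → A′`, `c : C → C′`, `b : B → B′`
(`a ≫ ψ′ = ψ ≫ c`, `a ≫ φ′ = φ ≫ b`) have intertwined factors: `c ≫ χ′ = χ ≫ b` (precompose with the epimorphism `ψ`).
[cite: MumfordAV1970, §7 Thm. 4 (p. 72)] -/
theorem comp_factor_eq_factor_comp {D : Over S} {φ : A.X ⟶ D} {χ : C.X ⟶ D} (hχ : ψ ≫ χ = φ)
    {A' : AbelianSchemeOver S} {C' D' : Over S} {ψ' : A'.X ⟶ C'} {φ' : A'.X ⟶ D'} {χ' : C' ⟶ D'} (hχ' : ψ' ≫ χ' = φ')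
    {a : A.X ⟶ A'.X} {c : C.X ⟶ C'} {b : D ⟶ D'} (hc : a ≫ ψ' = ψ ≫ c) (hb : a ≫ φ' = φ ≫ b) :
    c ≫ χ' = χ ≫ b := by
  apply A.cancel_left_of_flat_surjective ψ
  calc ψ ≫ c ≫ χ' = (a ≫ ψ') ≫ χ' := by rw [hc, Category.assoc]
    _ = a ≫ φ' := by rw [Category.assoc, hχ']
    _ = φ ≫ b := hb
    _ = ψ ≫ χ ≫ b := by rw [← hχ, Category.assoc]

/-- **EQUIVARIANCE OF THE FACTOR** (one triple): `ψ ≫ χ = φ` and endomorphisms `εA`, `εC`, `εB` with `εA ≫ ψ = ψ ≫ εC`, `εA ≫ φ = φ ≫ εB`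
give `εC ≫ χ = χ ≫ εB` — e.g. `χ` commutes with `𝒪`-actions intertwined by `ψ` and `φ`. [cite: MumfordAV1970, §7 Thm. 4 (p. 72)] -/
theorem comp_factor_eq_factor_comp_of_endo {D : Over S} {φ : A.X ⟶ D} {χ : C.X ⟶ D} (hχ : ψ ≫ χ = φ)
    {εA : A.X ⟶ A.X} {εC : C.X ⟶ C.X} {εB : D ⟶ D} (hC : εA ≫ ψ = ψ ≫ εC) (hB : εA ≫ φ = φ ≫ εB) : εC ≫ χ = χ ≫ εB :=
  A.comp_factor_eq_factor_comp ψ hχ hχ hC hB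

/-- **The recognition isomorphism is equivariant**: with `e : C ≅ D`, `ψ ≫ e.hom = φ`, endomorphisms intertwined by `ψ` and `φ` satisfy
`εC ≫ e.hom = e.hom ≫ εB` and `εB ≫ e.inv = e.inv ≫ εC`. [cite: MumfordAV1970, §7 Thm. 4 (p. 72)] -/
theorem comp_iso_eq_iso_comp_of_endo {D : Over S} {φ : A.X ⟶ D} (e : C.X ≅ D) (he : ψ ≫ e.hom = φ)
    {εA : A.X ⟶ A.X} {εC : C.X ⟶ C.X} {εB : D ⟶ D} (hC : εA ≫ ψ = ψ ≫ εC) (hB : εA ≫ φ = φ ≫ εB) :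
    εC ≫ e.hom = e.hom ≫ εB ∧ εB ≫ e.inv = e.inv ≫ εC := by
  have h1 : εC ≫ e.hom = e.hom ≫ εB := A.comp_factor_eq_factor_comp_of_endo ψ he hC hB
  refine ⟨h1, ?_⟩
  rw [← cancel_mono e.hom, Category.assoc, Category.assoc, e.inv_hom_id, Category.comp_id, h1, ← Category.assoc, e.inv_hom_id,
    Category.id_comp]

end Functorial

/-! ## §3 The descended ring action on the target of `ψ` -/

namespace RingAction

variable {A} {O : Type*} [CommRing O] (act : A.RingAction O)

/-- If `ψ` is already equivariant for SOME family of endomorphisms `j a` of `C` (`ι(a) ≫ ψ = ψ ≫ j a`), then `ι` stabilises `Ker ψ` on points.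
[cite: MumfordAV1970, §7 Thm. 4 (p. 72)] -/
theorem stabilises_ker_of_comp_eq {j : O → (C.X ⟶ C.X)} (hj : ∀ a, IsMonHom (j a)) (h : ∀ a, act.i a ≫ ψ = ψ ≫ j a)
    (a : O) ⦃T : Over S⦄ (t : T ⟶ A.X) (ht : t ≫ ψ = 1) : (t ≫ act.i a) ≫ ψ = 1 := by
  haveI := hj a
  rw [Category.assoc, h a, ← Category.assoc, ht, MonObj.one_comp]

/-- **`A[𝔭]` is `ι`-stable**: if `Ker ψ` is cut out on points by the action itself (`t ≫ ψ = 1 ↔ ∀ b ∈ 𝔭, t ≫ ι(b) = 1` for a set `𝔭 ⊆ 𝒪`,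
e.g. ★ `comp_serreTranslate_eq_one_iff_forall_mem`), then `ι` stabilises `Ker ψ` (`𝒪` is commutative: `ι(a) ι(b) = ι(b) ι(a)`).
[cite: Conrad2004GrossZagier, §7] -/
theorem stabilises_ker_of_ker_eq_torsion {𝔭 : Set O}
    (hker : ∀ ⦃T : Over S⦄ (t : T ⟶ A.X), t ≫ ψ = 1 ↔ ∀ b ∈ 𝔭, t ≫ act.i b = 1)
    (a : O) ⦃T : Over S⦄ (t : T ⟶ A.X) (ht : t ≫ ψ = 1) : (t ≫ act.i a) ≫ ψ = 1 := by
  rw [hker] at ht ⊢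
  intro b hb
  haveI := act.isMonHom a
  rw [Category.assoc, act.i_comm, ← Category.assoc, ht b hb, MonObj.one_comp]

variable [IsMonHom ψ] [Flat ψ.left] [Surjective ψ.left] [QuasiCompact ψ.left]
  (hstab : ∀ (a : O) ⦃T : Over S⦄ (t : T ⟶ A.X), t ≫ ψ = 1 → (t ≫ act.i a) ≫ ψ = 1)

include hstab in
/-- **`ι(a) ≫ ψ` descends uniquely through `ψ`** (it kills `Ker ψ` by stability), to a homomorphism.
[cite: MumfordAV1970, §7 Thm. 4 (p. 72)] [cite: SGA1, Exp. VIII Thm. 5.2] -/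
theorem exists_descend_i (a : O) :
    ∃ j : C.X ⟶ C.X, IsMonHom j ∧ ψ ≫ j = act.i a ≫ ψ ∧ ∀ j' : C.X ⟶ C.X, ψ ≫ j' = act.i a ≫ ψ → j' = j := by
  haveI := act.isMonHom a
  exact A.exists_isMonHom_comp_eq_of_forall_comp_eq_one ψ (act.i a ≫ ψ) fun T t ht => by
    rw [← Category.assoc]; exact hstab a t ht

/-- The descended endomorphism `ι_C(a)` of `C` (a choice of the unique descent of `ι(a) ≫ ψ` through `ψ`).
[cite: MumfordAV1970, §7 Thm. 4 (p. 72)] -/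
def descendMap (a : O) : C.X ⟶ C.X := (exists_descend_i ψ act hstab a).choose

/-- `ι_C(a)` is a homomorphism. [cite: MumfordAV1970, §7 Thm. 4 (p. 72)] -/
theorem isMonHom_descendMap (a : O) : IsMonHom (descendMap ψ act hstab a) := (exists_descend_i ψ act hstab a).choose_spec.1

/-- The defining square of `ι_C(a)`: `ψ ≫ ι_C(a) = ι(a) ≫ ψ`. [cite: MumfordAV1970, §7 Thm. 4 (p. 72)] -/
theorem comp_descendMap (a : O) : ψ ≫ descendMap ψ act hstab a = act.i a ≫ ψ := (exists_descend_i ψ act hstab a).choose_spec.2.1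

/-- Uniqueness of `ι_C(a)`. [cite: MumfordAV1970, §7 Thm. 4 (p. 72)] -/
theorem descendMap_unique (a : O) {j : C.X ⟶ C.X} (hj : ψ ≫ j = act.i a ≫ ψ) : j = descendMap ψ act hstab a :=
  (exists_descend_i ψ act hstab a).choose_spec.2.2 j hj

/-- **THE DESCENDED RING ACTION `ι_C` on the target of `ψ`**: `ι_C(a)` is the unique endomorphism of `C` with `ι(a) ≫ ψ = ψ ≫ ι_C(a)`; the ring-action
identities descend by uniqueness (`ψ` is an epimorphism).  This is the `𝒪`-structure «induced on the quotient `A ⁄ K`» for an `ι`-stable `K = Ker ψ`.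
[cite: MumfordAV1970, §7 Thm. 4 (p. 72)] [cite: Conrad2004GrossZagier, §7] -/
def descend : C.RingAction O where
  i := descendMap ψ act hstab
  isMonHom := isMonHom_descendMap ψ act hstab
  i_one := by
    apply A.cancel_left_of_flat_surjective ψ
    rw [comp_descendMap, act.i_one, Category.id_comp, Category.comp_id]
  i_mul a b := by
    apply A.cancel_left_of_flat_surjective ψ
    rw [comp_descendMap, act.i_mul, Category.assoc, ← comp_descendMap ψ act hstab a, ← Category.assoc,
      ← comp_descendMap ψ act hstab b, Category.assoc]
  i_zero := by
    apply A.cancel_left_of_flat_surjective ψ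
    rw [comp_descendMap, act.i_zero, MonObj.one_comp, MonObj.comp_one]
  i_add a b := by
    apply A.cancel_left_of_flat_surjective ψ
    rw [comp_descendMap, act.i_add, MonObj.mul_comp, ← comp_descendMap ψ act hstab a, ← comp_descendMap ψ act hstab b,
      MonObj.comp_mul]

/-- The action map of `descend` is `descendMap` (definitional). [cite: MumfordAV1970, §7 Thm. 4 (p. 72)] -/
theorem descend_i (a : O) : (descend ψ act hstab).i a = descendMap ψ act hstab a := rfl

/-- **`ψ` is equivariant for `ι` and the descended action**: `ι(a) ≫ ψ = ψ ≫ ι_C(a)`. [cite: MumfordAV1970, §7 Thm. 4 (p. 72)] -/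
theorem i_comp_eq_comp_descend_i (a : O) : act.i a ≫ ψ = ψ ≫ (descend ψ act hstab).i a :=
  (comp_descendMap ψ act hstab a).symm

/-- **Uniqueness of the descended action**: an endomorphism `j` of `C` with `ι(a) ≫ ψ = ψ ≫ j` IS `ι_C(a)`. [cite: MumfordAV1970, §7 Thm. 4 (p. 72)] -/
theorem eq_descend_i_of_comp_eq (a : O) {j : C.X ⟶ C.X} (hj : act.i a ≫ ψ = ψ ≫ j) : j = (descend ψ act hstab).i a :=
  descendMap_unique ψ act hstab a hj.symm

/-- … in particular any ring action `ι′` on `C` making `ψ` equivariant agrees with the descended one: `ι′(a) = ι_C(a)` for all `a`.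
[cite: MumfordAV1970, §7 Thm. 4 (p. 72)] -/
theorem descend_i_unique (act' : C.RingAction O) (h : ∀ a, act.i a ≫ ψ = ψ ≫ act'.i a) (a : O) :
    act'.i a = (descend ψ act hstab).i a :=
  eq_descend_i_of_comp_eq ψ act hstab a (h a)

end RingAction

/-! ## §4 The `𝒪`-equivariant recognition: two equivariant isogenies out of `A` with the same kernel and degree -/

section Recognition

variable {A} {O : Type*} [CommRing O] (actA : A.RingAction O) (actB : B.RingAction O) (actC : C.RingAction O) (φ : A.X ⟶ B.X)

/-- **The factor is `𝒪`-equivariant**: if `ψ ≫ χ = φ` with `ψ`, `φ` equivariant (`ι_A(a) ψ = ψ ι_C(a)`, `ι_A(a) φ = φ ι_B(a)`) and `ψ.left` flat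
surjective quasi-compact, then `ι_C(a) ≫ χ = χ ≫ ι_B(a)`. [cite: MumfordAV1970, §7 Thm. 4 (p. 72)] -/
theorem comp_factor_equivariant [Flat ψ.left] [Surjective ψ.left] [QuasiCompact ψ.left] {χ : C.X ⟶ B.X} (hχ : ψ ≫ χ = φ)
    (hψ : ∀ a, actA.i a ≫ ψ = ψ ≫ actC.i a) (hφ : ∀ a, actA.i a ≫ φ = φ ≫ actB.i a) (a : O) :
    actC.i a ≫ χ = χ ≫ actB.i a :=
  A.comp_factor_eq_factor_comp_of_endo ψ hχ (hψ a) (hφ a)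

/-- **`𝒪`-EQUIVARIANT UNIQUENESS OF THE QUOTIENT BY DEGREE** ([MumfordAV1970] §7 Thm. 4): `ψ : A → C`, `φ : A → B` `𝒪`-equivariant
homomorphisms with `ψ.left` finite flat surjective of constant rank `d`, `φ.left` finite flat of constant rank `d`, and `φ` killing `Ker ψ` on
points.  THEN there is an isomorphism `e : C ≅ B` over `S` with `ψ ≫ e = φ`; it is a homomorphism, it is `𝒪`-EQUIVARIANT (`ι_C(a) ≫ e = e ≫ ι_B(a)`),
and it is the unique factorisation.  Shape consumed by GEN∕HEART: «`(B, ι_B)` is `(A ⊗_𝒪 𝔭⁻¹, ι)`» for an equivariant isogeny `φ` killing exactly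
`A[𝔭]` (with `ψ :=` ★ `serreTranslate`). [cite: MumfordAV1970, §7 Thm. 4 (p. 72)] [cite: SGA1, Exp. VIII Thm. 5.2] [cite: Conrad2004GrossZagier, §7] -/
theorem exists_iso_comp_eq_equivariant_of_forall_comp_eq_one [IsMonHom ψ] [IsMonHom φ] [IsFinite ψ.left] [Flat ψ.left] [Surjective ψ.left]
    [IsFinite φ.left] [Flat φ.left] (hψ : ∀ a, actA.i a ≫ ψ = ψ ≫ actC.i a) (hφ : ∀ a, actA.i a ≫ φ = φ ≫ actB.i a)
    (hker : ∀ ⦃T : Over S⦄ (t : T ⟶ A.X), t ≫ ψ = 1 → t ≫ φ = 1)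
    (d : ℕ) (hdψ : ∀ c : C.left, ψ.left.finrank c = d) (hdφ : ∀ b : B.left, φ.left.finrank b = d) :
    ∃ e : C.X ≅ B.X, ψ ≫ e.hom = φ ∧ IsMonHom e.hom ∧ (∀ a, actC.i a ≫ e.hom = e.hom ≫ actB.i a) ∧
      ∀ χ : C.X ⟶ B.X, ψ ≫ χ = φ → χ = e.hom := by
  obtain ⟨e, he, hmon, huniq⟩ := A.exists_iso_comp_eq_of_forall_comp_eq_one ψ φ hker d hdψ hdφ
  exact ⟨e, he, hmon, fun a => (A.comp_iso_eq_iso_comp_of_endo ψ e he (hψ a) (hφ a)).1, huniq⟩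

end Recognition

end AbelianSchemeOver

end Literature.AlgebraicGeometry.AbelianSchemes

end
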